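import Mathlib.Analysis.Normed.Module.Connected
import Literature.Topology.FourManifolds.HomotopySpheres
import Literature.Topology.FourManifolds.SmoothOrientationDiffeomorphProofs
import HarnessLib

/-!
# Homotopy spheres and `Θₙ`: discharged facts (proofs)

Sibling proof file of `Literature.Topology.FourManifolds.HomotopySpheres` (D-0014: named facts
`def X : Prop` are discharged as `theorem X_holds : X`; users holding `(h : X)` are fed `X_holds`).
No definition and no statement of `HomotopySpheres.lean`, `SmoothOrientation.lean` or
`ConnectedSum.lean` is changed. Discharged here:

* `Diffeomorph.IsOrientationPreserving.trans_holds`, `Diffeomorph.IsOrientationPreserving.symm_holds`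
  (`SmoothOrientation.lean`): orientation-preserving `Cⁿ` diffeomorphisms (`n ≠ 0`) compose and
  invert (Hirsch, *Differential Topology* (1976), §4.4, p. 101 and Ex. 12 p. 104: `Diff₊(M)` is a
  group). Proofs: the chain rule (`Literature.Topology.FourManifolds.IsOrientationPreserving.comp_holds`,
  `Diffeomorph.det_mfderiv_ne_zero`, `Literature.Topology.FourManifolds.det_mul_det_eq_one_of_comp_eq_id`).
* `HomotopySphere.IsOrientedDiffeomorphic.symm_holds`, `.trans_holds`,
  `HomotopySphere.equivalence_isOrientedDiffeomorphic_holds`, `HomotopySphereClass.mk_eq_mk_iff_holds`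
  (`HomotopySpheres.lean`; Kervaire–Milnor, *Groups of homotopy spheres I*, Ann. of Math. 77
  (1963), §1: "It is clear that this is an equivalence relation").

Proved API added on the way (Kervaire–Milnor 1963, §2, Lemma 2.1 "commutative"):
`Literature.Topology.FourManifolds.IsOrientedConnectedSum.symm` (`(M, oM) # (N, oN) = (N, oN) # (M, oM)` for the *same* glued
manifold: swap the discs and replace the disc orientation `o₀` by `-o₀`),
`Literature.Topology.FourManifolds.HomotopySphereClass.IsMul.symm`, `Literature.Topology.FourManifolds.HomotopySphereClass.isMul_comm`, and the point-set
facts `HomotopySphere.nonempty`, `HomotopySphere.connectedSpace` (`n ≠ 0`; theorems, not instances) used by the group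
structure on `Θₙ` (`HomotopySpheresGroup.lean`).

## References

* M. Kervaire, J. Milnor, *Groups of homotopy spheres I*, Ann. of Math. (2) 77 (1963), 504–537,
  §§1–2, Lemma 2.1. doi:10.2307/1970128 [KervaireMilnorAnnals1963]
* M. W. Hirsch, *Differential Topology*, GTM 33, Springer (1976), Ch. 4 §4, p. 101 and Ex. 12,
  p. 104. [HirschDT1976]
-/

open scoped Manifold ContDiff Topology ContinuousMap
open Set Module

noncomputable section

/-! ### Orientation-preserving diffeomorphisms compose and invert -/

namespace Literature.Topology.FourManifolds

section DiffeomorphHolds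

variable {E H H' H'' : Type*} [NormedAddCommGroup E] [NormedSpace ℝ E] [TopologicalSpace H]
  [TopologicalSpace H'] [TopologicalSpace H''] {I : ModelWithCorners ℝ E H}
  {I' : ModelWithCorners ℝ E H'} {I'' : ModelWithCorners ℝ E H''}
  {M : Type*} [TopologicalSpace M] [ChartedSpace H M] [IsManifold I 1 M]
  {N : Type*} [TopologicalSpace N] [ChartedSpace H' N] [IsManifold I' 1 N]
  {P : Type*} [TopologicalSpace P] [ChartedSpace H'' P] [IsManifold I'' 1 P] {n : WithTop ℕ∞}

/-- **Discharge** of `Diffeomorph.IsOrientationPreserving.trans`: orientation-preserving `Cⁿ`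
diffeomorphisms (`n ≠ 0`) compose. The chain rule case of `Literature.Topology.FourManifolds.IsOrientationPreserving.comp_holds`:
diffeomorphisms are differentiable with nowhere-vanishing Jacobian
(`Diffeomorph.det_mfderiv_ne_zero`). Hirsch, *Differential Topology* (1976), §4.4, p. 101 and
Ex. 12, p. 104 (`Diff₊` is a group). [cite: HirschDT1976, §4.4 p. 101; Ex. 12 p. 104] -/
theorem _root_.Diffeomorph.IsOrientationPreserving.trans_holds :
    Diffeomorph.IsOrientationPreserving.trans (I := I) (I' := I') (I'' := I'') (M := M) (N := N)
      (P := P) (n := n) := by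
  intro φ ψ oM oN oP hφ hψ hn
  show Literature.Topology.FourManifolds.IsOrientationPreserving oM oP ⇑(φ.trans ψ)
  rw [Diffeomorph.coe_trans]
  exact IsOrientationPreserving.comp_holds hψ hφ (ψ.mdifferentiable hn) (φ.mdifferentiable hn)
    (ψ.det_mfderiv_ne_zero hn) (φ.det_mfderiv_ne_zero hn)

/-- **Discharge** of `Diffeomorph.IsOrientationPreserving.symm`: the inverse of an
orientation-preserving `Cⁿ` diffeomorphism (`n ≠ 0`) is orientation preserving. By the chain rule
`dφ_{φ⁻¹ y} ∘ d(φ⁻¹)_y = id`, so the two Jacobian determinants have the same sign, while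
`oM (φ⁻¹ y) = oN y` is `oN (φ x) = oM x` at `x = φ⁻¹ y`. Hirsch, *Differential Topology* (1976),
§4.4, p. 101 and Ex. 12, p. 104. [cite: HirschDT1976, §4.4 p. 101; Ex. 12 p. 104] -/
theorem _root_.Diffeomorph.IsOrientationPreserving.symm_holds :
    Diffeomorph.IsOrientationPreserving.symm (I := I) (I' := I') (M := M) (N := N) (n := n) := by
  intro φ oM oN hφ hn y
  set x := φ.symm y with hx
  have hy : φ x = y := φ.apply_symm_apply y
  -- chain rule at `y`: `dφ_x ∘ dφ⁻¹_y = id`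
  have hchain : mfderiv I' I' (φ ∘ φ.symm) y =
      (mfderiv I I' φ (φ.symm y)).comp (mfderiv I' I φ.symm y) :=
    mfderiv_comp y (φ.mdifferentiable hn (φ.symm y)) (φ.symm.mdifferentiable hn y)
  have hid : (φ : M → N) ∘ φ.symm = id := funext fun z => φ.apply_symm_apply z
  rw [hid, mfderiv_id] at hchain
  -- `a * b = 1`, hence `0 < a ↔ 0 < b`
  set a := LinearMap.det (M := E) (mfderiv I I' φ x).toLinearMap with ha
  set b := LinearMap.det (M := E) (mfderiv I' I φ.symm y).toLinearMap with hb
  have hprod : a * b = 1 := det_mul_det_eq_one_of_comp_eq_id (E := E) hchain.symm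
  have ha0 : a ≠ 0 := left_ne_zero_of_mul_eq_one hprod
  have hb0 : b ≠ 0 := right_ne_zero_of_mul_eq_one hprod
  have hab : (0 < a ↔ 0 < b) := (mul_pos_iff_pos_iff_pos ha0 hb0).mp (hprod ▸ one_pos)
  have hφx : (oN (φ x) = oM x ↔ 0 < a) := hφ x
  show (oM (φ.symm y) = oN y ↔ 0 < b)
  rw [← hab, ← hφx, hy, ← hx]
  exact eq_comm

end DiffeomorphHolds

/-! ### Oriented diffeomorphism of homotopy spheres is an equivalence relation -/

/-- Local notation: `𝔼 n` is the model Euclidean space `EuclideanSpace ℝ (Fin n)`. -/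
local notation "𝔼 " n:arg => EuclideanSpace ℝ (Fin n)

/-- Local notation: `𝕊 n` is the unit sphere in `EuclideanSpace ℝ (Fin (n + 1))`, the standard
`n`-sphere with its Mathlib analytic manifold structure. -/
local notation "𝕊 " n:arg => (Metric.sphere (0 : EuclideanSpace ℝ (Fin (n + 1))) 1)

namespace HomotopySphere

variable {n : ℕ}

/-- **Discharge** of `HomotopySphere.IsOrientedDiffeomorphic.symm`: oriented diffeomorphism of
homotopy spheres is symmetric (inverse diffeomorphism; Kervaire–Milnor 1963, §1, "It is clear that
this is an equivalence relation"). [cite: KervaireMilnorAnnals1963, §1] -/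
theorem IsOrientedDiffeomorphic.symm_holds : IsOrientedDiffeomorphic.symm (n := n) := by
  intro S T h
  obtain ⟨φ, hφ⟩ := h
  exact ⟨φ.symm, Diffeomorph.IsOrientationPreserving.symm_holds hφ (by simp)⟩

/-- **Discharge** of `HomotopySphere.IsOrientedDiffeomorphic.trans`: oriented diffeomorphism of
homotopy spheres is transitive (composition; Kervaire–Milnor 1963, §1). [cite: KervaireMilnorAnnals1963, §1] -/
theorem IsOrientedDiffeomorphic.trans_holds : IsOrientedDiffeomorphic.trans (n := n) := by
  intro S T U h₁ h₂
  obtain ⟨φ, hφ⟩ := h₁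
  obtain ⟨ψ, hψ⟩ := h₂
  exact ⟨φ.trans ψ, Diffeomorph.IsOrientationPreserving.trans_holds hφ hψ (by simp)⟩

/-- **Discharge** of `HomotopySphere.equivalence_isOrientedDiffeomorphic`: oriented diffeomorphism
is an equivalence relation on homotopy `n`-spheres (Kervaire–Milnor 1963, §1). [cite: KervaireMilnorAnnals1963, §1] -/
theorem equivalence_isOrientedDiffeomorphic_holds : equivalence_isOrientedDiffeomorphic (n := n) :=
  ⟨IsOrientedDiffeomorphic.refl, fun h => IsOrientedDiffeomorphic.symm_holds h,
    fun h₁ h₂ => IsOrientedDiffeomorphic.trans_holds h₁ h₂⟩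

/-- A homotopy sphere is nonempty: the homotopy inverse maps the nonempty sphere `𝕊ⁿ` into it
(Kervaire–Milnor 1963, §1). A theorem rather than an instance (proof files add no instances). [folklore] -/
theorem nonempty (S : HomotopySphere n) : Nonempty S.carrier := by
  obtain ⟨e⟩ := S.nonempty_homotopyEquiv
  have : Nonempty (𝕊 n) :=
    ⟨⟨EuclideanSpace.single (0 : Fin (n + 1)) (1 : ℝ), by simp⟩⟩
  exact ⟨e.symm (Classical.arbitrary _)⟩

/-- A homotopy `n`-sphere, `n ≠ 0`, is path connected: `𝕊ⁿ` is (`isPathConnected_sphere`), and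
path components are homotopy invariants — if `g ∘ f ≃ id` then `x` is joined to `g (f x)` along the
homotopy, and `g` maps paths of `𝕊ⁿ` to paths (Hatcher, *Algebraic Topology*, §2.1 / Ex. 0.10).
False for `n = 0` (`𝕊⁰` is two points). [folklore] -/
theorem pathConnectedSpace (hn : n ≠ 0) (S : HomotopySphere n) : PathConnectedSpace S.carrier := by
  obtain ⟨e⟩ := S.nonempty_homotopyEquiv
  have hS : PathConnectedSpace (𝕊 n) := by
    refine isPathConnected_iff_pathConnectedSpace.mp (isPathConnected_sphere ?_ 0 zero_le_one)
    rw [← Module.finrank_eq_rank, finrank_euclideanSpace_fin]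
    exact Nat.one_lt_cast.mpr (by omega)
  obtain ⟨F⟩ := e.left_inv
  have hj : ∀ x : S.carrier, Joined (e.invFun (e.toFun x)) x := fun x => ⟨F.evalAt x⟩
  refine ⟨S.nonempty, fun x y => ?_⟩
  exact ((hj x).symm.trans
    ⟨(PathConnectedSpace.somePath (e.toFun x) (e.toFun y)).map e.invFun.continuous⟩).trans (hj y)

/-- A homotopy `n`-sphere, `n ≠ 0`, is connected (Kervaire–Milnor 1963, §2 apply the connected
sum to homotopy spheres, which requires connectedness). [folklore] -/
theorem connectedSpace (hn : n ≠ 0) (S : HomotopySphere n) : ConnectedSpace S.carrier :=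
  haveI := S.pathConnectedSpace hn
  inferInstance

end HomotopySphere

namespace HomotopySphereClass

variable {n : ℕ}

/-- **Discharge** of `HomotopySphereClass.mk_eq_mk_iff`: two homotopy spheres have the same class in
`Θₙ` iff they are oriented-diffeomorphic — `Quot.eq` plus the fact that an equivalence relation is
its own equivalence closure (Kervaire–Milnor 1963, §1). [cite: KervaireMilnorAnnals1963, §1] -/
theorem mk_eq_mk_iff_holds : mk_eq_mk_iff (n := n) := by
  intro S T
  exact Quot.eq.trans (HomotopySphere.equivalence_isOrientedDiffeomorphic_holds (n := n)).eqvGen_iff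

/-- Equal classes in `Θₙ` come from oriented-diffeomorphic homotopy spheres (the useful direction of
`mk_eq_mk_iff_holds`; Kervaire–Milnor 1963, §1). [cite: KervaireMilnorAnnals1963, §1] -/
theorem exact {S T : HomotopySphere n} (h : mk S = mk T) : S.IsOrientedDiffeomorphic T :=
  mk_eq_mk_iff_holds.mp h

end HomotopySphereClass

/-! ### The oriented connected sum is symmetric -/

section OrientedSymm

variable {E HM HN HP : Type*} [NormedAddCommGroup E] [NormedSpace ℝ E]
  [TopologicalSpace HM] {IM : ModelWithCorners ℝ E HM}
  [TopologicalSpace HN] {IN : ModelWithCorners ℝ E HN}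
  [TopologicalSpace HP] {IP : ModelWithCorners ℝ E HP}
  {M N P : Type*} [TopologicalSpace M] [T2Space M] [ChartedSpace HM M] [IsManifold IM 1 M]
  [TopologicalSpace N] [T2Space N] [ChartedSpace HN N] [IsManifold IN 1 N]
  [TopologicalSpace P] [ChartedSpace HP P] [IsManifold IP 1 P]

/-- **The oriented connected sum is symmetric**: if `(P, oP)` is an oriented connected sum
`(M, oM) # (N, oN)` then it is an oriented connected sum `(N, oN) # (M, oM)`, with the same glued
manifold: exchange the two discs and gluing maps, replace the disc orientation `o₀` by `-o₀` (so
that the formerly reversing disc `i₂` becomes the preserving one), and substitute `t ↦ 1 - t` in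
Kervaire–Milnor's relation (`connectedSumRel_swap`). Kervaire–Milnor 1963, Lemma 2.1
("commutative up to orientation preserving diffeomorphism" — here even with the identity).
[cite: KervaireMilnorAnnals1963, Lemma 2.1] -/
theorem IsOrientedConnectedSum.symm {oM : SmoothOrientation IM M} {oN : SmoothOrientation IN N}
    {oP : SmoothOrientation IP P} (h : IsOrientedConnectedSum oM oN oP) :
    IsOrientedConnectedSum oN oM oP := by
  obtain ⟨i₁, i₂, o₀, jA, jB, h₁, h₂, ho₁, ho₂, ⟨hA, hAo, hB, hBo, hU, hR⟩, hjA, hjB⟩ := h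
  refine ⟨i₂, i₁, -o₀, jB, jA, h₂, h₁, ?_, ?_, ⟨hB, hBo, hA, hAo, (union_comm _ _).trans hU, ?_⟩,
    hjB, hjA⟩
  · -- `i₂` reverses `o₀`, i.e. preserves `-o₀`
    rw [← SmoothOrientation.neg_modelSpace, ← _root_.neg_neg oN,
      isOrientationPreserving_neg_neg_iff]
    exact ho₂
  · -- `i₁` preserves `o₀`, i.e. reverses `-o₀`
    rw [IsOrientationReversing, ← SmoothOrientation.neg_modelSpace,
      isOrientationPreserving_neg_neg_iff]
    exact ho₁
  · intro b a
    rw [← connectedSumRel_swap, Function.swap, eq_comm]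
    exact hR a b

/-- `(P, oP)` is an oriented connected sum `M # N` iff it is an oriented connected sum `N # M`
(Kervaire–Milnor 1963, Lemma 2.1, "commutative"). [cite: KervaireMilnorAnnals1963, Lemma 2.1] -/
theorem isOrientedConnectedSum_comm {oM : SmoothOrientation IM M} {oN : SmoothOrientation IN N}
    {oP : SmoothOrientation IP P} :
    IsOrientedConnectedSum oM oN oP ↔ IsOrientedConnectedSum oN oM oP :=
  ⟨IsOrientedConnectedSum.symm, IsOrientedConnectedSum.symm⟩

end OrientedSymm

namespace HomotopySphereClass

variable {n : ℕ}

/-- **Commutativity of the group law of `Θₙ`** in relational form: `a # b = c → b # a = c`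
(Kervaire–Milnor 1963, Lemma 2.1, "commutative"; from `IsOrientedConnectedSum.symm`). [cite: KervaireMilnorAnnals1963, Lemma 2.1] -/
theorem IsMul.symm {a b c : HomotopySphereClass n} (h : IsMul a b c) : IsMul b a c := by
  obtain ⟨S, T, U, hS, hT, hU, hSTU⟩ := h
  exact ⟨T, S, U, hT, hS, hU, hSTU.symm⟩

/-- `a # b = c ↔ b # a = c` in `Θₙ` (Kervaire–Milnor 1963, Lemma 2.1, "commutative"). [cite: KervaireMilnorAnnals1963, Lemma 2.1] -/
theorem isMul_comm {a b c : HomotopySphereClass n} : IsMul a b c ↔ IsMul b a c :=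
  ⟨IsMul.symm, IsMul.symm⟩

/-- Reversing all orientations is compatible with the group law: `a # b = c → (-a) # (-b) = -c`
(Kervaire–Milnor 1963, §2, `(-M) # (-N) = -(M # N)`; from `IsOrientedConnectedSum.neg`). [cite: KervaireMilnorAnnals1963, §2] -/
theorem IsMul.neg {a b c : HomotopySphereClass n} (h : IsMul a b c) : IsMul a.neg b.neg c.neg := by
  obtain ⟨S, T, U, rfl, rfl, rfl, hSTU⟩ := h
  exact ⟨S.neg, T.neg, U.neg, rfl, rfl, rfl, hSTU.neg⟩

end HomotopySphereClass

end Literature.Topology.FourManifolds
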